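import Summits.CriticalPhenomena.SAWScalingLimit.Theorems.LeftRightFKG.Negative.BoxDomain
import HarnessLib

/-!
# Crux `LeftRightFKG` (stmt-CriticalPhenomena-11232), line `corner-localisation` (v9):
the boundary walk of every lattice rectangle (`stub_rectBoundaryWalk`, tool T1)

For every lattice rectangle `[x₀, x₁] × [y₀, y₁]` (`x₀ < x₁`, `y₀ < y₁`) we construct the
closed lattice walk based at the corner `(x₀, y₀)` tracing its boundary counter-clockwise —
east along `y = y₀`, north along `x = x₁`, west along `y = y₁`, south along `x = x₀` — and
verify the four decidable side conditions under which `Negative.Rect.meshVertices_Ω` /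
`Rect.meshDomain_Ω` / `Rect.dAdj_iff` identify the crux's domain `{z | wind(C − z) ≠ 0}`
(`δ = 1`) with the open box of sites: support in the closed rectangle, consecutive vertices on
a common wall line, every wall lattice point visited, and signed crossing count `-1` over the
upward probe of the corner face `(x₀, y₀)` (the only dart crossing the line `x = x₀ + ½` at a
height `≥ y₀ + 1` is the westward top-wall dart `(x₀ + 1, y₁) → (x₀, y₁)`).

Straight segments `f s, f (s+1), …, f e` of a lattice line `f : ℤ → Site 2` are built by
induction on the length (`exists_line_walk`) together with a description of their vertices
and darts; the closed walk is `east · north · west' · (crossing edge · south)`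
(`SimpleGraph.Walk.append`), and all four properties are read off the vertices / darts of the
pieces (`SimpleGraph.Walk.mem_support_append_iff`, `SimpleGraph.Walk.darts_append`,
`Negative.wcross_append`, `Negative.wcross_eq_darts`). No named facts are used. [folklore]
-/

open Literature.Probability.LatticeModels Literature.Probability.RandomPlanarGeometry
open Summit.CriticalPhenomena.SAWScalingLimit.Theorems.LeftRightFKG.Negative (bx pathCross wcross)

namespace Summit.CriticalPhenomena.SAWScalingLimit.Theorems.LeftRightFKG.Families

/-! ## Straight lattice segments and dart bookkeeping -/

/-- The straight walk `f s, f (s+1), …, f e` (`e = s + n`) along a lattice line `f` whose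
consecutive values are adjacent: its vertices are the `f t`, `s ≤ t ≤ e`, and its darts are
the `f t → f (t + 1)`, `s ≤ t < e`. [folklore] -/
private theorem exists_line_walk (f : ℤ → Site 2)
    (hf : ∀ t : ℤ, (zdGraph 2).Adj (f t) (f (t + 1))) :
    ∀ (n : ℕ) (s e : ℤ), e = s + n → ∀ (u v : Site 2), u = f s → v = f e →
      ∃ w : (zdGraph 2).Walk u v,
        (∀ x ∈ w.support, ∃ t : ℤ, s ≤ t ∧ t ≤ e ∧ x = f t) ∧
        (∀ t : ℤ, s ≤ t → t ≤ e → f t ∈ w.support) ∧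
        (∀ d ∈ w.darts, ∃ t : ℤ, s ≤ t ∧ t + 1 ≤ e ∧ d.fst = f t ∧ d.snd = f (t + 1))
  | 0, s, e, he, u, v, hu, hv => by
    obtain rfl : e = s := by omega
    subst hu hv
    refine ⟨SimpleGraph.Walk.nil, ?_, ?_, ?_⟩
    · intro x hx
      rw [SimpleGraph.Walk.support_nil, List.mem_singleton] at hx
      exact ⟨e, le_rfl, le_rfl, hx⟩
    · intro t h1 h2
      obtain rfl : t = e := le_antisymm h2 h1
      simp
    · intro d hd
      simp at hd
  | n + 1, s, e, he, u, v, hu, hv => by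
    obtain ⟨w, h1, h2, h3⟩ :=
      exists_line_walk f hf n (s + 1) e (by omega) (f (s + 1)) v rfl hv
    subst hu
    refine ⟨SimpleGraph.Walk.cons (hf s) w, ?_, ?_, ?_⟩
    · intro x hx
      rw [SimpleGraph.Walk.support_cons, List.mem_cons] at hx
      rcases hx with rfl | hx
      · exact ⟨s, le_rfl, by omega, rfl⟩
      · obtain ⟨t, ht1, ht2, rfl⟩ := h1 x hx
        exact ⟨t, by omega, ht2, rfl⟩
    · intro t ht1 ht2
      rw [SimpleGraph.Walk.support_cons, List.mem_cons]
      rcases eq_or_lt_of_le ht1 with rfl | hlt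
      · exact Or.inl rfl
      · exact Or.inr (h2 t (by omega) ht2)
    · intro d hd
      rw [SimpleGraph.Walk.darts_cons, List.mem_cons] at hd
      rcases hd with rfl | hd
      · exact ⟨s, le_rfl, by omega, rfl, rfl⟩
      · obtain ⟨t, ht1, ht2, hd1, hd2⟩ := h3 d hd
        exact ⟨t, by omega, ht2, hd1, hd2⟩

/-- A relation holding on every dart of a walk chains its vertex list. [folklore] -/
private theorem isChain_of_darts {R : Site 2 → Site 2 → Prop} :
    ∀ {u v : Site 2} (w : (zdGraph 2).Walk u v), (∀ d ∈ w.darts, R d.fst d.snd) →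
      List.IsChain R (u :: w.support.tail)
  | _, _, SimpleGraph.Walk.nil, _ => List.isChain_singleton _
  | u, _, SimpleGraph.Walk.cons (v := v') h p, hd => by
    rw [SimpleGraph.Walk.support_cons, List.tail_cons, ← p.cons_tail_support,
      List.isChain_cons_cons]
    rw [SimpleGraph.Walk.darts_cons] at hd
    exact ⟨hd ⟨(u, v'), h⟩ (by simp),
      isChain_of_darts p fun d hd' => hd d (List.mem_cons_of_mem _ hd')⟩

/-- A walk none of whose darts crosses the probe has signed crossing count `0`. [folklore] -/
private theorem wcross_eq_zero_of_darts (m k : ℤ) {u v : Site 2} (w : (zdGraph 2).Walk u v)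
    (h : ∀ d ∈ w.darts, Negative.edgeCross m k d.fst d.snd = 0) : wcross m k w = 0 := by
  rw [Negative.wcross_eq_darts]
  refine List.sum_eq_zero fun x hx => ?_
  obtain ⟨d, hd, rfl⟩ := List.mem_map.1 hx
  exact h d hd

/-- The signed crossing count of a walk splits off its first dart. [folklore] -/
private theorem wcross_cons (m k : ℤ) {u v w : Site 2} (h : (zdGraph 2).Adj u v)
    (p : (zdGraph 2).Walk v w) :
    wcross m k (SimpleGraph.Walk.cons h p) = Negative.edgeCross m k u v + wcross m k p := by
  simp [Negative.wcross_eq_darts]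

/-! ## The boundary walk of a rectangle -/

/-- **Registered stub `stub_rectBoundaryWalk` (tool T1).** For every lattice rectangle
`[x₀, x₁] × [y₀, y₁]` (`x₀ < x₁`, `y₀ < y₁`) there is a closed lattice walk based at the corner
`(x₀, y₀)` tracing its boundary counter-clockwise, with the side conditions of
`Negative.Rect.meshVertices_Ω` / `meshDomain_Ω` / `dAdj_iff`: support in the closed rectangle,
consecutive vertices on a common wall line, every wall lattice point visited, and signed crossing
count `-1` over the probe of the corner face `(x₀, y₀)`. [folklore] -/
theorem stub_rectBoundaryWalk : ∀ (x₀ x₁ y₀ y₁ : ℤ), x₀ < x₁ → y₀ < y₁ →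
    ∃ C : (zdGraph 2).Walk (bx x₀ y₀) (bx x₀ y₀),
      (∀ x ∈ C.support, (x₀ ≤ x 0 ∧ x 0 ≤ x₁) ∧ (y₀ ≤ x 1 ∧ x 1 ≤ y₁)) ∧
      List.IsChain (fun p q : Site 2 => (p 1 = y₀ ∧ q 1 = y₀) ∨ (p 0 = x₁ ∧ q 0 = x₁) ∨
        (p 1 = y₁ ∧ q 1 = y₁) ∨ (p 0 = x₀ ∧ q 0 = x₀)) (bx x₀ y₀ :: C.support.tail) ∧
      (∀ i j : ℤ, x₀ ≤ i → i ≤ x₁ → y₀ ≤ j → j ≤ y₁ → (i = x₀ ∨ i = x₁ ∨ j = y₀ ∨ j = y₁) →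
        bx i j ∈ C.support) ∧
      pathCross x₀ y₀ (bx x₀ y₀) C.support.tail = -1 := by
  intro x₀ x₁ y₀ y₁ hx hy
  obtain ⟨N₁, hN₁⟩ := Int.eq_ofNat_of_zero_le (show (0 : ℤ) ≤ x₁ - x₀ by omega)
  obtain ⟨N₂, hN₂⟩ := Int.eq_ofNat_of_zero_le (show (0 : ℤ) ≤ y₁ - y₀ by omega)
  obtain ⟨N₃, hN₃⟩ := Int.eq_ofNat_of_zero_le (show (0 : ℤ) ≤ x₁ - x₀ - 1 by omega)
  -- bottom wall, eastward: `(x₀, y₀) → (x₁, y₀)`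
  obtain ⟨W₁, hs₁, hm₁, hd₁⟩ := exists_line_walk (fun t => bx (x₀ + t) y₀)
    (fun t => Negative.adj_bx (x₀ + t) y₀ (x₀ + (t + 1)) y₀ (Or.inl ⟨by ring, rfl⟩))
    N₁ 0 (x₁ - x₀) (by omega) (bx x₀ y₀) (bx x₁ y₀) (by simp)
    (by show bx x₁ y₀ = bx (x₀ + (x₁ - x₀)) y₀; congr 1; omega)
  -- right wall, northward: `(x₁, y₀) → (x₁, y₁)`
  obtain ⟨W₂, hs₂, hm₂, hd₂⟩ := exists_line_walk (fun t => bx x₁ (y₀ + t))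
    (fun t => Negative.adj_bx x₁ (y₀ + t) x₁ (y₀ + (t + 1))
      (Or.inr (Or.inr (Or.inl ⟨by ring, rfl⟩))))
    N₂ 0 (y₁ - y₀) (by omega) (bx x₁ y₀) (bx x₁ y₁) (by simp)
    (by show bx x₁ y₁ = bx x₁ (y₀ + (y₁ - y₀)); congr 1; omega)
  -- top wall, westward, all but its last edge: `(x₁, y₁) → (x₀ + 1, y₁)`
  obtain ⟨W₃, hs₃, hm₃, hd₃⟩ := exists_line_walk (fun t => bx (x₁ - t) y₁)
    (fun t => Negative.adj_bx (x₁ - t) y₁ (x₁ - (t + 1)) y₁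
      (Or.inr (Or.inl ⟨by ring, rfl⟩)))
    N₃ 0 (x₁ - x₀ - 1) (by omega) (bx x₁ y₁) (bx (x₀ + 1) y₁) (by simp)
    (by show bx (x₀ + 1) y₁ = bx (x₁ - (x₁ - x₀ - 1)) y₁; congr 1; omega)
  -- left wall, southward: `(x₀, y₁) → (x₀, y₀)`
  obtain ⟨W₄, hs₄, hm₄, hd₄⟩ := exists_line_walk (fun t => bx x₀ (y₁ - t))
    (fun t => Negative.adj_bx x₀ (y₁ - t) x₀ (y₁ - (t + 1))
      (Or.inr (Or.inr (Or.inr ⟨by ring, rfl⟩))))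
    N₂ 0 (y₁ - y₀) (by omega) (bx x₀ y₁) (bx x₀ y₀) (by simp)
    (by show bx x₀ y₀ = bx x₀ (y₁ - (y₁ - y₀)); congr 1; omega)
  -- the last edge of the top wall, the one crossing the probe: `(x₀ + 1, y₁) → (x₀, y₁)`
  have hE : (zdGraph 2).Adj (bx (x₀ + 1) y₁) (bx x₀ y₁) :=
    Negative.adj_bx _ _ _ _ (Or.inr (Or.inl ⟨rfl, rfl⟩))
  refine ⟨W₁.append (W₂.append (W₃.append (SimpleGraph.Walk.cons hE W₄))), ?_, ?_, ?_, ?_⟩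
  · -- support in the closed rectangle
    intro x hx
    simp only [SimpleGraph.Walk.mem_support_append_iff, SimpleGraph.Walk.support_cons,
      List.mem_cons] at hx
    rcases hx with hx | hx | hx | rfl | hx
    · obtain ⟨t, ht0, ht1, rfl⟩ := hs₁ x hx
      simp only [Negative.bx_zero, Negative.bx_one]; omega
    · obtain ⟨t, ht0, ht1, rfl⟩ := hs₂ x hx
      simp only [Negative.bx_zero, Negative.bx_one]; omega
    · obtain ⟨t, ht0, ht1, rfl⟩ := hs₃ x hx
      simp only [Negative.bx_zero, Negative.bx_one]; omega
    · simp only [Negative.bx_zero, Negative.bx_one]; omega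
    · obtain ⟨t, ht0, ht1, rfl⟩ := hs₄ x hx
      simp only [Negative.bx_zero, Negative.bx_one]; omega
  · -- consecutive vertices on a common wall line
    refine isChain_of_darts _ fun d hd => ?_
    simp only [SimpleGraph.Walk.darts_append, SimpleGraph.Walk.darts_cons, List.mem_append,
      List.mem_cons] at hd
    rcases hd with hd | hd | hd | rfl | hd
    · obtain ⟨t, -, -, h1, h2⟩ := hd₁ d hd
      rw [h1, h2]; simp
    · obtain ⟨t, -, -, h1, h2⟩ := hd₂ d hd
      rw [h1, h2]; simp
    · obtain ⟨t, -, -, h1, h2⟩ := hd₃ d hd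
      rw [h1, h2]; simp
    · simp
    · obtain ⟨t, -, -, h1, h2⟩ := hd₄ d hd
      rw [h1, h2]; simp
  · -- every wall lattice point is visited
    intro i j hi hi' hj hj' hw
    simp only [SimpleGraph.Walk.mem_support_append_iff, SimpleGraph.Walk.support_cons,
      List.mem_cons]
    rcases hw with rfl | rfl | rfl | rfl
    · -- left wall
      refine Or.inr (Or.inr (Or.inr (Or.inr ?_)))
      have h := hm₄ (y₁ - j) (by omega) (by omega)
      rwa [show y₁ - (y₁ - j) = j by omega] at h
    · -- right wall
      refine Or.inr (Or.inl ?_)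
      have h := hm₂ (j - y₀) (by omega) (by omega)
      rwa [show y₀ + (j - y₀) = j by omega] at h
    · -- bottom wall
      refine Or.inl ?_
      have h := hm₁ (i - x₀) (by omega) (by omega)
      rwa [show x₀ + (i - x₀) = i by omega] at h
    · -- top wall: its left end is the start of the left wall, the rest is on `W₃`
      by_cases hi0 : i = x₀
      · subst hi0
        refine Or.inr (Or.inr (Or.inr (Or.inr ?_)))
        have h := hm₄ 0 le_rfl (by omega)
        rwa [sub_zero] at h
      · refine Or.inr (Or.inr (Or.inl ?_))
        have h := hm₃ (x₁ - i) (by omega) (by omega)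
        rwa [show x₁ - (x₁ - i) = i by omega] at h
  · -- the signed crossing count over the probe of the corner face
    have h₁ : wcross x₀ y₀ W₁ = 0 := wcross_eq_zero_of_darts x₀ y₀ W₁ fun d hd => by
      obtain ⟨t, -, -, h1, h2⟩ := hd₁ d hd
      rw [h1, h2]; simp only [Negative.edgeCross, Negative.bx_zero, Negative.bx_one, true_and]
      split_ifs <;> omega
    have h₂ : wcross x₀ y₀ W₂ = 0 := wcross_eq_zero_of_darts x₀ y₀ W₂ fun d hd => by
      obtain ⟨t, -, -, h1, h2⟩ := hd₂ d hd
      rw [h1, h2]; simp only [Negative.edgeCross, Negative.bx_zero, Negative.bx_one]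
      split_ifs <;> omega
    have h₃ : wcross x₀ y₀ W₃ = 0 := wcross_eq_zero_of_darts x₀ y₀ W₃ fun d hd => by
      obtain ⟨t, -, ht1, h1, h2⟩ := hd₃ d hd
      rw [h1, h2]; simp only [Negative.edgeCross, Negative.bx_zero, Negative.bx_one, true_and]
      split_ifs <;> omega
    have h₄ : wcross x₀ y₀ W₄ = 0 := wcross_eq_zero_of_darts x₀ y₀ W₄ fun d hd => by
      obtain ⟨t, -, -, h1, h2⟩ := hd₄ d hd
      rw [h1, h2]; simp only [Negative.edgeCross, Negative.bx_zero, Negative.bx_one, true_and]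
      split_ifs <;> omega
    show wcross x₀ y₀ (W₁.append (W₂.append (W₃.append (SimpleGraph.Walk.cons hE W₄)))) = -1
    rw [Negative.wcross_append, Negative.wcross_append, Negative.wcross_append, wcross_cons,
      h₁, h₂, h₃, h₄]
    simp only [Negative.edgeCross, Negative.bx_zero, Negative.bx_one, true_and]
    split_ifs <;> omega

end Summit.CriticalPhenomena.SAWScalingLimit.Theorems.LeftRightFKG.Families
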